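import Summits.BirchSwinnertonDyer.BirchSwinnertonDyer.Theorems.BiquadraticEisensteinDescentHeegnerTwistCouplingInSupplySylvesterTwistPhiHatThreeAdic
import Literature.NumberTheory.QuadraticFields.SqrtNegTwoFieldPrimes
import Literature.NumberTheory.Automorphic.GaloisActionPlaces
import HarnessLib

set_option linter.dupNamespace false -- `Summit.BirchSwinnertonDyer.BirchSwinnertonDyer.Theorems.…` (summit = sub, D-0017)
set_option autoImplicit false

/-!
# Crux `HeegnerTwistCouplingInSupply` (stmt-BirchSwinnertonDyer-21381) — programme «TWISTED 3-ISOGENY DESCENT», file P6a: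
# valuations of a norm-cube `φ̂`-Selmer candidate `u ∈ K = ℚ(√−2)` for the Sylvester twist (`c' = 3pθ`, `θ² = −2`)

Route `BiquadraticEisensteinDescent` (cell `pub/bsd-wall`, width seat `bsd-wall-cm-bed-w4` g32; `--supports` 21381, helper). The
`φ̂`-side box of the descent on `W_p^{(−8)} ≅ y² = x³ − 2p²`: over the Kummer field `K ∋ θ`, `θ² = −2` (`[K:ℚ] = 2`), the `μ₃`-kernel
Mordell datum is `E' = mordellCurve(−3c'²)`, `c' = 3pθ`; a class `[C_u] ∈ Ш(E'/K)` with `u · c(u) = r³` (`c` the conjugation of `K`,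
`r ∈ K` fixed by `c` — the NORM-CUBE condition of `TwistedKummerCharacterNorm`) has:

* §1 ★ `three_dvd_log_valuation_of_good` — `3 ∣ v(u)` at every finite place `v ∌ 2, 3, p` (local necessity
  `exists_phiDescent_eq_adicCompletion_of_torsorClass_mem_sha` + descent valuations `three_dvd_log_cubicDescent` in `K_v`,
  `v(54pθ) = 0`);
* §2 `three_dvd_log_add_log_smul` — `3 ∣ v(u) + (c • v)(u)` at EVERY `v` (norm-cube; `v(c u) = (c • v)(u)`);
  ★ `three_dvd_log_valuation_of_two_mem` — `3 ∣ v(u)` at the place above `2` (it is `c`-FIXED: `v ∋ θ`, `(θ)` prime);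
* §3 ★ `three_dvd_log_valuation_of_three_mem` / `exists_eq_cube_adicCompletion_of_three_mem` — at `v ∋ 3`: `c • v ≠ v` (`3` splits,
  `3 = (1+θ)(1−θ)`), so file P6b applies: `u` is a CUBE in `K_v`, in particular `3 ∣ v(u)`.

So `3 ∣ v(u)` at every `v ∌ p`, and at the two places over `p` the valuations sum to `0 (mod 3)`: the input of the assembly file P6c
(class group trivial, units `±1`, the certificate `9 ∤ x`). HONEST FRAMING: local/valuation lemmas of a support-layer programme on ONE CM
family; the crux (residual C⁺), its registered stubs, `hDescU` itself and BSD are untouched. THEOREMS ONLY (no `def`, no named fact, no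
sorry). Supports stmt-BirchSwinnertonDyer-21381.
[cite: SilvermanAEC2009, Thm. X.4.2 (a), Prop. X.4.9, Thm. X.1.1 (c)] [cite: CohenPazuki2009, Definition 1.3 (G₃), Proposition 2.2]
[cite: CasselsFrohlichANT1967, Ch. VII §1.1]
-/

noncomputable section

open scoped Classical WithZero Pointwise

namespace Summit.BirchSwinnertonDyer.BirchSwinnertonDyer.Theorems.SylvesterTwistDescent

open Literature.NumberTheory.EllipticCurves Literature.NumberTheory.EllipticCurves.MordellDescent
open Literature.NumberTheory.NumberFields IsDedekindDomain IsDedekindDomain.HeightOneSpectrum NumberField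
open Literature.NumberTheory.Automorphic Literature.NumberTheory.QuadraticFields
open WithZero (log exp)

variable {K : Type} [Field K] [NumberField K] (hK2 : Module.finrank ℚ K = 2) {θ : K} (hθ : θ ^ 2 = -2)
  (hK : SqrtNegTwo.FieldData θ)
  (c : K ≃ₐ[ℚ] K) (hc : c ≠ 1) {p : ℕ} (hc' : (3 * p * θ : K) ≠ 0) {D : K} (hD : D = -3 * (3 * p * θ) ^ 2)
  {u : K} (hu : u ≠ 0) (hsha : torsorClass hc' hD hu ∈ (mordellCurve D).sha)

/-! ## §0 Small helpers -/

/-- `a b = x³`, `v(a − b) = 1`, `a, b ≠ 0` ⟹ `ord_v(a) ∈ 3ℤ` (the tree's `Valuation.three_dvd_log_of_mul_eq_cube`, re-proved here because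
its module has no build on the farm). [cite: SilvermanAEC2009, Thm. X.1.1(c)] -/
private theorem exists_log_eq_three_mul_of_mul_eq_cube {L : Type*} [Field L] (w : Valuation L ℤᵐ⁰) {a b x : L} (ha : a ≠ 0)
    (hb : b ≠ 0) (hsub : w (a - b) = 1) (h : a * b = x ^ 3) : ∃ k : ℤ, log (w a) = 3 * k := by
  have hva : w a ≠ 0 := (w.ne_zero_iff).mpr ha
  have hvb : w b ≠ 0 := (w.ne_zero_iff).mpr hb
  have hx : x ≠ 0 := by
    rintro rfl
    rw [zero_pow three_ne_zero, mul_eq_zero] at h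
    exact h.elim ha hb
  have hprod : w a * w b = w x ^ 3 := by rw [← map_mul, h, map_pow]
  by_cases hab : w a = w b
  · have key : w a ^ 2 = w x ^ 3 := by rw [sq, ← hprod, hab]
    have hlog := congrArg WithZero.log key
    rw [WithZero.log_pow, WithZero.log_pow, nsmul_eq_mul, nsmul_eq_mul] at hlog
    push_cast at hlog
    exact ⟨log (w a) - log (w x), by linarith⟩
  · have hmax : max (w a) (w b) = 1 := by
      have := w.map_add_of_distinct_val (x := a) (y := -b) (by rwa [Valuation.map_neg])
      rw [← sub_eq_add_neg, hsub, Valuation.map_neg] at this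
      exact this.symm
    rcases lt_or_gt_of_ne hab with hlt | hlt
    · have hb1 : w b = 1 := by rw [max_eq_right hlt.le] at hmax; exact hmax
      rw [hb1, mul_one] at hprod
      have hlog := congrArg WithZero.log hprod
      rw [WithZero.log_pow, nsmul_eq_mul] at hlog
      push_cast at hlog
      exact ⟨log (w x), by linarith⟩
    · have ha1 : w a = 1 := by rw [max_eq_left hlt.le] at hmax; exact hmax
      exact ⟨0, by rw [ha1, WithZero.log_one]; ring⟩

/-- `ord_v(phiDescent c P) ∈ 3ℤ` for every point `P` of `Y² = X³ + 81c²` when `v(18c) = 1` (the tree's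
`Valuation.three_dvd_log_cubicDescent` for `B = 9c`, re-proved here). [cite: SilvermanAEC2009, Thm. X.1.1(c)] -/
private theorem exists_log_phiDescent_eq_three_mul {L : Type*} [Field L] [CharZero L] (w : Valuation L ℤᵐ⁰) {c₀ : L}
    (hv : w (2 * (9 * c₀)) = 1) (P : (mordellCurve (81 * c₀ ^ 2)).toAffine.Point) :
    ∃ k : ℤ, log (w (phiDescent c₀ P)) = 3 * k := by
  have h2B : (2 : L) * (9 * c₀) ≠ 0 := fun h0 ↦ by rw [h0, map_zero] at hv; exact zero_ne_one hv
  have hB : (9 : L) * c₀ ≠ 0 := fun h0 ↦ h2B (by rw [h0, mul_zero])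
  have hW : mordellCurve (81 * c₀ ^ 2) = mordellCurve ((9 * c₀) ^ 2) := by congr 1; ring
  rw [phiDescent_eq_cubicDescent]
  rcases P with _ | ⟨X, Y, hP⟩
  · exact ⟨0, by rw [← WeierstrassCurve.Affine.Point.zero_def, cubicDescent_zero, map_one, WithZero.log_one]; ring⟩
  · have hE : Y ^ 2 = X ^ 3 + (9 * c₀) ^ 2 := (equation_iff_of_eq hW X Y).mp hP.1
    rw [cubicDescent_some]
    split_ifs with hY
    · exact ⟨0, by rw [map_pow, hv, one_pow, WithZero.log_one]; ring⟩
    · by_cases hX : X = 0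
      · have hYB : Y = 9 * c₀ := by
          rcases y_eq_or_of_x_eq_zero hW hP.1 hX with h | h
          · exact h
          · exact absurd h hY
        exact ⟨0, by rw [hYB, ← two_mul, hv, WithZero.log_one]; ring⟩
      · refine exists_log_eq_three_mul_of_mul_eq_cube w (b := Y - 9 * c₀) (x := X) (fun h ↦ hY ?_) (fun h ↦ hX ?_)
          (by rw [show Y + 9 * c₀ - (Y - 9 * c₀) = 2 * (9 * c₀) by ring, hv]) ?_
        · linear_combination h
        · have : X ^ 3 = 0 := by
            have hYB : Y = 9 * c₀ := by linear_combination h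
            rw [hYB] at hE; linear_combination hE.symm
          exact pow_eq_zero_iff three_ne_zero |>.mp this
        · linear_combination hE

include hθ in
omit [NumberField K] in
/-- `θ` is integral (`θ² + 2 = 0`). [cite: SilvermanAEC2009, X.§4] -/
private theorem isIntegral_theta : IsIntegral ℤ θ := by
  refine ⟨Polynomial.X ^ 2 + Polynomial.C 2, Polynomial.monic_X_pow_add_C _ two_ne_zero, ?_⟩
  simp [hθ]

omit [NumberField K] in
/-- `((n : 𝓞 K) : K) = n`. [folklore] -/
theorem coe_natCast_ringOfIntegers (n : ℕ) : (((n : ℕ) : 𝓞 K) : K) = n := by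
  rw [RingOfIntegers.coe_eq_algebraMap, map_natCast]

/-- The valuation of a natural number prime to `v` is `1`. [cite: CasselsFrohlichANT1967, Ch. VII §1.1] -/
theorem valuation_natCast_eq_one (v : HeightOneSpectrum (𝓞 K)) {n : ℕ} (hn : ((n : ℕ) : 𝓞 K) ∉ v.asIdeal) :
    v.valuation K (n : K) = 1 := by
  have : (n : K) = algebraMap (𝓞 K) K (n : 𝓞 K) := by simp
  rw [this, valuation_eq_one_iff_notMem]
  exact hn

include hθ in
/-- `v(θ) = 1` at a place not above `2` (`θ² = −2` is a `v`-unit). [cite: CasselsFrohlichANT1967, Ch. VII §1.1] -/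
theorem valuation_theta_eq_one (v : HeightOneSpectrum (𝓞 K)) (h2 : ((2 : ℕ) : 𝓞 K) ∉ v.asIdeal) : v.valuation K θ = 1 := by
  set θ' : 𝓞 K := ⟨θ, isIntegral_theta hθ⟩ with hθ'
  have hθK : (θ : K) = algebraMap (𝓞 K) K θ' := rfl
  have hle : v.valuation K θ ≤ 1 := by rw [hθK]; exact valuation_le_one v θ'
  have hsq : v.valuation K θ * v.valuation K θ = 1 := by
    rw [← map_mul, ← sq, hθ, Valuation.map_neg]
    exact_mod_cast valuation_natCast_eq_one v (n := 2) h2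
  by_contra hne
  have hlt : v.valuation K θ < 1 := lt_of_le_of_ne hle hne
  have : v.valuation K θ * v.valuation K θ < 1 := by
    calc v.valuation K θ * v.valuation K θ ≤ v.valuation K θ * 1 := by gcongr
      _ = v.valuation K θ := mul_one _
      _ < 1 := hlt
  rw [hsq] at this
  exact lt_irrefl _ this

/-! ## §1 Good places: `3 ∣ v(u)` for `v ∌ 2, 3, p` -/

include hθ hsha in
/-- ★ **`3 ∣ v(u)` at the good places.** If `[C_u] ∈ Ш(E'/K)` (`E' = mordellCurve(−3c'²)`, `c' = 3pθ`) then at every finite place `v` of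
`K` with `2, 3, p ∉ v` the valuation of `u` is divisible by `3`: in `K_v`, `u·w³ = phiDescent c' P` for a local point `P` (local necessity),
and descent values have valuation `≡ 0 (mod 3)` where `2·9c' = 54pθ` is a unit. [cite: SilvermanAEC2009, Thm. X.4.2 (a), Prop. X.4.9, Thm. X.1.1 (c)] -/
theorem three_dvd_log_valuation_of_good (v : HeightOneSpectrum (𝓞 K)) (h2 : ((2 : ℕ) : 𝓞 K) ∉ v.asIdeal)
    (h3 : ((3 : ℕ) : 𝓞 K) ∉ v.asIdeal) (hpv : ((p : ℕ) : 𝓞 K) ∉ v.asIdeal) :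
    (3 : ℤ) ∣ log (v.valuation K u) := by
  obtain ⟨P, w, hw0, hPw⟩ := exists_phiDescent_eq_adicCompletion_of_torsorClass_mem_sha hc' hD hu hsha v
  haveI : CharZero (v.adicCompletion K) :=
    charZero_of_injective_algebraMap (algebraMap K (v.adicCompletion K)).injective
  -- the valuation on `K_v` restricts to `v` on `K`
  have hval : ∀ k : K, Valued.v (algebraMap K (v.adicCompletion K) k) = v.valuation K k :=
    fun k => valuedAdicCompletion_eq_valuation' v k
  -- `2 · 9c'` is a `v`-unit
  have h2B : Valued.v ((2 : v.adicCompletion K) * (9 * algebraMap K (v.adicCompletion K) (3 * p * θ))) = 1 := by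
    have : (2 : v.adicCompletion K) * (9 * algebraMap K (v.adicCompletion K) (3 * p * θ)) =
        algebraMap K (v.adicCompletion K) ((2 : ℕ) * ((3 : ℕ) ^ 3 * ((p : ℕ) * θ))) := by
      simp only [map_mul, map_natCast, map_ofNat, map_pow]; push_cast; ring
    rw [this, hval, map_mul, map_mul, map_mul, map_pow, valuation_natCast_eq_one v h2, valuation_natCast_eq_one v h3,
      valuation_natCast_eq_one v hpv, valuation_theta_eq_one hθ v h2]
    simp
  obtain ⟨k, hk⟩ := exists_log_phiDescent_eq_three_mul (Valued.v : Valuation (v.adicCompletion K) ℤᵐ⁰) h2B P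
  rw [hPw, Valuation.map_mul, Valuation.map_pow, hval] at hk
  have hu0 : v.valuation K u ≠ 0 := (Valuation.ne_zero_iff _).mpr hu
  have hw0' : Valued.v w ≠ 0 := (Valuation.ne_zero_iff _).mpr hw0
  rw [WithZero.log_mul hu0 (pow_ne_zero 3 hw0'), WithZero.log_pow, nsmul_eq_mul] at hk
  push_cast at hk
  exact ⟨k - log (Valued.v w), by linarith⟩

/-! ## §2 The norm-cube condition: conjugate places; the place above `2` -/

include hK2 in
/-- `c` is an involution (`[K:ℚ] = 2`). [cite: CasselsFrohlichANT1967, Ch. VII §1.1] -/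
private theorem algEquiv_mul_self : c * c = 1 := by
  have hcard : Fintype.card (K ≃ₐ[ℚ] K) ≤ 2 := hK2 ▸ AlgEquiv.card_le
  have hdvd : orderOf c ∣ Fintype.card (K ≃ₐ[ℚ] K) := orderOf_dvd_card
  have hle : orderOf c ≤ 2 := (Nat.le_of_dvd Fintype.card_pos hdvd).trans hcard
  have hpos : 0 < orderOf c := orderOf_pos c
  have h2 : c ^ 2 = 1 := by
    interval_cases h : orderOf c
    · rw [orderOf_eq_one_iff.mp h, one_pow]
    · rw [← h, pow_orderOf_eq_one]
  rw [← sq]; exact h2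

include hK2 in
/-- `v(c u) = (c • v)(u)`. [cite: CasselsFrohlichANT1967, Ch. VII §1.1] -/
theorem valuation_algEquiv_apply (v : HeightOneSpectrum (𝓞 K)) (x : K) : v.valuation K (c x) = (c • v).valuation K x := by
  have h := HeightOneSpectrum.valuation_smul (L := K) c (c • v) x
  rw [smul_smul, algEquiv_mul_self hK2 c, one_smul] at h
  rw [← h]; rfl

include hK2 in
/-- **`3 ∣ v(u) + (c • v)(u)` at every finite place**, from the norm-cube condition `u · c(u) = r³`.
[cite: CohenPazuki2009, Definition 1.3 (G₃)] -/
theorem three_dvd_log_add_log_smul {u : K} (hu : u ≠ 0) (hnorm : ∃ r : K, c r = r ∧ r ≠ 0 ∧ u * c u = r ^ 3) (v : HeightOneSpectrum (𝓞 K)) :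
    (3 : ℤ) ∣ log (v.valuation K u) + log ((c • v).valuation K u) := by
  obtain ⟨r, -, hr0, hr⟩ := hnorm
  have h := congrArg (v.valuation K) hr
  rw [map_mul, map_pow, valuation_algEquiv_apply hK2 c v u] at h
  have hu0 : v.valuation K u ≠ 0 := (Valuation.ne_zero_iff _).mpr hu
  have hu0' : (c • v).valuation K u ≠ 0 := (Valuation.ne_zero_iff _).mpr hu
  have hr0' : v.valuation K r ≠ 0 := (Valuation.ne_zero_iff _).mpr hr0
  have hlog := congrArg log h
  rw [WithZero.log_mul hu0 hu0', WithZero.log_pow, nsmul_eq_mul] at hlog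
  exact ⟨log (v.valuation K r), by rw [hlog]; push_cast; ring⟩

include hK in
/-- **The prime `(θ)` of `𝓞 K`**: `θ' = hK.ringEquiv √−2` is a prime element (norm `2`), so `(θ')` is a MAXIMAL ideal.
[cite: Marcus2018, Ch. 3 Thm. 25] -/
theorem isMaximal_span_theta : (Ideal.span {(hK.ringEquiv Zsqrtd.sqrtd : 𝓞 K)}).IsMaximal := by
  have hpr : Prime (Zsqrtd.sqrtd : ℤ√(-2)) :=
    SqrtNegTwoPrimary.prime_of_norm_eq_prime Nat.prime_two (by simp [Zsqrtd.norm_def])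
  have hpr' : Prime (hK.ringEquiv Zsqrtd.sqrtd : 𝓞 K) := (MulEquiv.prime_iff hK.ringEquiv).mpr hpr
  have hP : (Ideal.span {(hK.ringEquiv Zsqrtd.sqrtd : 𝓞 K)}).IsPrime := (Ideal.span_singleton_prime hpr'.ne_zero).mpr hpr'
  exact hP.isMaximal (by rw [Ne, Ideal.span_singleton_eq_bot]; exact hpr'.ne_zero)

include hK in
/-- A place containing `2` IS the place `(θ)`. [cite: Marcus2018, Ch. 3 Thm. 25] -/
theorem asIdeal_eq_of_two_mem (v : HeightOneSpectrum (𝓞 K)) (h2 : ((2 : ℕ) : 𝓞 K) ∈ v.asIdeal) :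
    v.asIdeal = Ideal.span {(hK.ringEquiv Zsqrtd.sqrtd : 𝓞 K)} := by
  -- `θ'² = −2 ∈ v`, so `θ' ∈ v`
  have hsq : (hK.ringEquiv Zsqrtd.sqrtd : 𝓞 K) * hK.ringEquiv Zsqrtd.sqrtd = -((2 : ℕ) : 𝓞 K) := by
    apply Subtype.ext
    change ((hK.ringEquiv Zsqrtd.sqrtd : 𝓞 K) : K) * ((hK.ringEquiv Zsqrtd.sqrtd : 𝓞 K) : K) = -(((2 : ℕ) : 𝓞 K) : K)
    rw [hK.coe_ringEquiv_sqrtd, ← sq, hK.sq_eq, RingOfIntegers.coe_eq_algebraMap, map_natCast]; push_cast; ring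
  have hmem : (hK.ringEquiv Zsqrtd.sqrtd : 𝓞 K) ∈ v.asIdeal := by
    have : (hK.ringEquiv Zsqrtd.sqrtd : 𝓞 K) * hK.ringEquiv Zsqrtd.sqrtd ∈ v.asIdeal := by
      rw [hsq]; exact v.asIdeal.neg_mem_iff.mpr h2
    exact (v.isPrime.mem_or_mem this).elim id id
  have hle : Ideal.span {(hK.ringEquiv Zsqrtd.sqrtd : 𝓞 K)} ≤ v.asIdeal := by
    rw [Ideal.span_singleton_le_iff_mem]; exact hmem
  exact ((isMaximal_span_theta hK).eq_of_le v.isPrime.ne_top hle).symm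

include hK in
/-- **The place above `2` is `c`-fixed**: `c • v = v` for `v ∋ 2` (both `v` and `c • v` contain `2`, hence equal `(θ)`).
[cite: CasselsFrohlichANT1967, Ch. VII §1.1] -/
theorem smul_eq_of_two_mem (v : HeightOneSpectrum (𝓞 K)) (h2 : ((2 : ℕ) : 𝓞 K) ∈ v.asIdeal) : c • v = v := by
  have h2' : ((2 : ℕ) : 𝓞 K) ∈ (c • v).asIdeal := by
    rw [HeightOneSpectrum.smul_asIdeal]
    have e : c • ((2 : ℕ) : 𝓞 K) = ((2 : ℕ) : 𝓞 K) := by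
      apply RingOfIntegers.ext
      rw [RingOfIntegers.coe_algEquiv_smul, coe_natCast_ringOfIntegers, map_natCast]
    have : c • ((2 : ℕ) : 𝓞 K) ∈ c • v.asIdeal := Ideal.smul_mem_pointwise_smul_iff.mpr h2
    rwa [e] at this
  exact HeightOneSpectrum.ext ((asIdeal_eq_of_two_mem hK (c • v) h2').trans (asIdeal_eq_of_two_mem hK v h2).symm)

include hK2 hK in
/-- ★ **`3 ∣ v(u)` at the place above `2`** from the norm-cube condition (`(c • v)(u) = v(u)` there, so `2v(u) = 3v(r)`).
[cite: CohenPazuki2009, Definition 1.3 (G₃)] -/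
theorem three_dvd_log_valuation_of_two_mem {u : K} (hu : u ≠ 0) (hnorm : ∃ r : K, c r = r ∧ r ≠ 0 ∧ u * c u = r ^ 3)
    (v : HeightOneSpectrum (𝓞 K)) (h2 : ((2 : ℕ) : 𝓞 K) ∈ v.asIdeal) : (3 : ℤ) ∣ log (v.valuation K u) := by
  have h := three_dvd_log_add_log_smul hK2 c hu hnorm v
  rw [smul_eq_of_two_mem hK c v h2, ← two_mul] at h
  have h32 : IsCoprime (3 : ℤ) 2 := by norm_num
  exact h32.dvd_of_dvd_mul_left h

/-! ## §3 The places over `3`: `c • v ≠ v`, and `u` is a cube in `K_v` -/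

include hθ in
/-- For `v ∋ 3`, **`c • v ≠ v`** (`3 = (1 + θ)(1 − θ)` splits: `v` contains one of `1 ± θ`; a `c`-fixed `v` would contain both, hence `2`
and `3`, hence `1`). [cite: CasselsFrohlichANT1967, Ch. VII §1.1] -/
theorem smul_ne_of_three_mem (hcθ : c θ = -θ) (v : HeightOneSpectrum (𝓞 K)) (h3 : ((3 : ℕ) : 𝓞 K) ∈ v.asIdeal) : c • v ≠ v := by
  intro hfix
  set θ' : 𝓞 K := ⟨θ, isIntegral_theta hθ⟩ with hθ'
  have hfac : ((1 : 𝓞 K) + θ') * (1 - θ') = ((3 : ℕ) : 𝓞 K) := by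
    apply Subtype.ext
    change ((1 : K) + θ) * (1 - θ) = (((3 : ℕ) : 𝓞 K) : K)
    have : (1 + θ) * (1 - θ) = 1 - θ ^ 2 := by ring
    rw [this, hθ, coe_natCast_ringOfIntegers]; push_cast; ring
  have hcθ' : c • θ' = -θ' := by
    apply Subtype.ext
    change c θ = -θ
    exact hcθ
  -- one of `1 ± θ'` lies in `v`; then so does its conjugate, as `c • v = v`
  have hmem : (1 : 𝓞 K) + θ' ∈ v.asIdeal ∧ (1 : 𝓞 K) - θ' ∈ v.asIdeal := by
    have hprod : ((1 : 𝓞 K) + θ') * (1 - θ') ∈ v.asIdeal := by rw [hfac]; exact h3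
    have hconj : ∀ x : 𝓞 K, x ∈ v.asIdeal → c • x ∈ v.asIdeal := by
      intro x hx
      have : c • x ∈ (c • v).asIdeal := by
        rw [HeightOneSpectrum.smul_asIdeal]; exact Ideal.smul_mem_pointwise_smul_iff.mpr hx
      rwa [hfix] at this
    rcases v.isPrime.mem_or_mem hprod with h | h
    · refine ⟨h, ?_⟩
      have := hconj _ h
      rwa [smul_add, smul_one, hcθ', ← sub_eq_add_neg] at this
    · refine ⟨?_, h⟩
      have := hconj _ h
      rwa [smul_sub, smul_one, hcθ', sub_neg_eq_add] at this
  have h2 : (2 : 𝓞 K) ∈ v.asIdeal := by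
    have := v.asIdeal.add_mem hmem.1 hmem.2
    rwa [show ((1 : 𝓞 K) + θ') + (1 - θ') = 2 by ring] at this
  have h1 : (1 : 𝓞 K) ∈ v.asIdeal := by
    have := v.asIdeal.sub_mem h3 h2
    rwa [show (((3 : ℕ) : 𝓞 K)) - 2 = 1 by norm_num] at this
  exact v.isPrime.ne_top ((Ideal.eq_top_iff_one _).mpr h1)

include hK2 hθ hsha in
/-- ★ **At `v ∋ 3`, `u` is a cube in `K_v`** (file P6b, with the conjugate place `c • v ≠ v`), for `p ≡ 8 (mod 9)`.
[cite: SilvermanAEC2009, Thm. X.4.2 (a), Prop. X.4.9] [cite: CohenPazuki2009, §4] -/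
theorem exists_eq_cube_adicCompletion_of_three_mem (hcθ : c θ = -θ) (hp : p % 9 = 8) (v : HeightOneSpectrum (𝓞 K))
    (h3 : ((3 : ℕ) : 𝓞 K) ∈ v.asIdeal) :
    ∃ z : v.adicCompletion K, z ≠ 0 ∧ algebraMap K (v.adicCompletion K) u = z ^ 3 := by
  have hne := smul_ne_of_three_mem hθ c hcθ v h3
  have h3' : ((3 : ℕ) : 𝓞 K) ∈ (c • v).asIdeal := by
    rw [HeightOneSpectrum.smul_asIdeal]
    have e : c • ((3 : ℕ) : 𝓞 K) = ((3 : ℕ) : 𝓞 K) := by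
      apply RingOfIntegers.ext
      rw [RingOfIntegers.coe_algEquiv_smul, coe_natCast_ringOfIntegers, map_natCast]
    have : c • ((3 : ℕ) : 𝓞 K) ∈ c • v.asIdeal := Ideal.smul_mem_pointwise_smul_iff.mpr h3
    rwa [e] at this
  exact exists_eq_cube_adicCompletion_three_of_torsorClass_mem_sha hK2 hθ h3 h3' hne hp hc' hD hu hsha

include hK2 hθ hsha in
/-- ★ **`3 ∣ v(u)` at the places over `3`.** [cite: SilvermanAEC2009, Thm. X.4.2 (a), Prop. X.4.9] -/
theorem three_dvd_log_valuation_of_three_mem (hcθ : c θ = -θ) (hp : p % 9 = 8) (v : HeightOneSpectrum (𝓞 K))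
    (h3 : ((3 : ℕ) : 𝓞 K) ∈ v.asIdeal) : (3 : ℤ) ∣ log (v.valuation K u) := by
  obtain ⟨z, hz0, hz⟩ := exists_eq_cube_adicCompletion_of_three_mem hK2 hθ c hc' hD hu hsha hcθ hp v h3
  have hval : Valued.v (algebraMap K (v.adicCompletion K) u) = v.valuation K u := valuedAdicCompletion_eq_valuation' v u
  rw [← hval, hz, Valuation.map_pow, WithZero.log_pow, nsmul_eq_mul]
  exact ⟨log (Valued.v z), by push_cast; ring⟩

end Summit.BirchSwinnertonDyer.BirchSwinnertonDyer.Theorems.SylvesterTwistDescent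

end
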